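import Summits.CriticalPhenomena.PercolationContinuityZ3.Theorems.Transplant.FKConnectivityAllQAntipodalRootForm3Dual
import Summits.CriticalPhenomena.PercolationContinuityZ3.Theorems.Transplant.FKConnectivityAllQAntipodalOddConeLevel4

/-!
# Connectivity correlation inequalities for `φ_{w,q}`, every `q > 0` — file 74h: **`C_∞⁺` AT LEVEL 4 ON SERIES–PARALLEL GRAPHS, UNCONDITIONALLY**
# (the four `T2` rays discharged; `T2⁺` at an arbitrary position)

Support file (`--supports stmt-CriticalPhenomena-4575`), FK sub-lane `prim-bschramm-fk-2` (gen 32); builds on p205010 (kernel theorem,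
internal audit signed; external expert review pending).  No definitions, no named facts, no sorries; standard axioms.  Memo
FROM-fk-2-g31-DUALITY.md §0/§4 (A), FROM-fk-2-g32-*.md; FK-Q2 §41.

File 64h (`FK.apPsiC_levels_le_read4_nonpos_of_T2`) proved `C_∞⁺` at level 4 — every coefficient, in the edge odds and in the cluster weight `q`, of
`Z_H(z,q)² Cov_{φ_{z,q}}(f, g)/(q − 1)` is nonnegative for every increasing `f` reading four edges `x, y, z, w` and every increasing `g` blind to them,
in every cell of every 2-connected series–parallel graph — MODULO the four `T2` rays of the level-4 odd cone (`hub·OR(rest) ∨ AND(rest)`, hub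
`x, y, z, w`; Conjecture `T2⁺`, the serq square of memo FROM-fk-2-g29 §8).  File 74g proves `T2⁺` with the hub at the root
(`FK.RootForm.t2_levels_le_nonpos_of_isTTSP`); Duffin re-rooting (`FK.IsTTSP.reroot_erase`) moves the root onto any hub
(`apPsiC_levels_le_t2Set_nonpos_of_isTTSP`), so the hypothesis `hT2` of file 64h is discharged in all four placements:
**`apPsiC_levels_le_read4_nonpos_of_isTTSP` — `C_∞⁺` AT LEVEL 4 FOR EVERY INCREASING `f` OF FOUR EDGES, EVERY CELL, EVERY 2-CONNECTED
SERIES–PARALLEL GRAPH, with no hypothesis left.**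
[cite: Grimmett2006, §1.4 eq. (1.20) (p. 15); §3.8 Thm. (3.90) (pp. 61–62); §3.9 (pp. 63–64); §6.1 eq. (6.3) (p. 133)]
[cite: Wagner2006, Thm. 5.8(d), §5.3]
-/

noncomputable section

namespace Summit.CriticalPhenomena.PercolationContinuityZ3.Theorems

namespace FK

open SimpleGraph Finset Literature.Probability.LatticeModels Literature.Probability.Percolation
open scoped Classical

variable {V : Type*} [Fintype V]

/-- **`T2⁺` at an arbitrary position, partial sums by cluster level.**  `E` TTSP between `s, t`, `st ∉ E`, `H = E ∪ {st}`; `e₁, e₂, e₃, e₄ ∈ H`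
distinct (`e₁` the hub); `N, C ⊆ H \ {e₁,e₂,e₃,e₄}` disjoint; `g` increasing, blind to `e₁, …, e₄`.  Then for every level cut-off `J`, with
`M' = {e₁,e₂,e₃,e₄} ∪ N` and `T2 X = 1{(e₁ ∈ X ∧ (e₂ ∈ X ∨ e₃ ∈ X ∨ e₄ ∈ X)) ∨ (e₂ ∈ X ∧ e₃ ∈ X ∧ e₄ ∈ X)}`:
`∑_{γ ⊆ M' : k(γ∪C)+k((M'\γ)∪C) ≤ J} (T2(γ∪C) − T2((M'\γ)∪C))·(g(γ∪C) − g((M'\γ)∪C)) ≤ 0`.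
Proof: re-root `H` at `e₁` and apply file 74g. [cite: Grimmett2006, §3.8 Thm. (3.90) (pp. 61–62); §3.9 (pp. 63–64)]
[cite: Wagner2006, Thm. 5.8(d), §5.3] -/
theorem apPsiC_levels_le_t2Set_nonpos_of_isTTSP {E : Finset (Sym2 V)} {s t : V} (hE : IsTTSP E s t) (hst : s(s, t) ∉ E)
    {e₁ e₂ e₃ e₄ : Sym2 V} (h₁ : e₁ ∈ insert s(s, t) E) (h₂ : e₂ ∈ insert s(s, t) E) (h₃ : e₃ ∈ insert s(s, t) E) (h₄ : e₄ ∈ insert s(s, t) E)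
    (h₁₂ : e₁ ≠ e₂) (h₁₃ : e₁ ≠ e₃) (h₁₄ : e₁ ≠ e₄) (h₂₃ : e₂ ≠ e₃) (h₂₄ : e₂ ≠ e₄) (h₃₄ : e₃ ≠ e₄) {N C : Finset (Sym2 V)}
    (hN : N ⊆ ((((insert s(s, t) E).erase e₁).erase e₂).erase e₃).erase e₄)
    (hC : C ⊆ ((((insert s(s, t) E).erase e₁).erase e₂).erase e₃).erase e₄)
    (hNC : Disjoint N C) {g : Finset (Sym2 V) → ℝ} (hg₁ : ∀ A : Finset (Sym2 V), g (insert e₁ A) = g A)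
    (hg₂ : ∀ A : Finset (Sym2 V), g (insert e₂ A) = g A) (hg₃ : ∀ A : Finset (Sym2 V), g (insert e₃ A) = g A)
    (hg₄ : ∀ A : Finset (Sym2 V), g (insert e₄ A) = g A)
    (hmono : ∀ ⦃X Y : Finset (Sym2 V)⦄, X ⊆ Y → g X ≤ g Y) (J : ℕ) :
    ∑ γ ∈ (insert e₁ (insert e₂ (insert e₃ (insert e₄ N)))).powerset with apExpC (insert e₁ (insert e₂ (insert e₃ (insert e₄ N)))) C γ ≤ J,
        (((fun X : Finset (Sym2 V) => if (e₁ ∈ X ∧ (e₂ ∈ X ∨ e₃ ∈ X ∨ e₄ ∈ X)) ∨ (e₂ ∈ X ∧ e₃ ∈ X ∧ e₄ ∈ X) then (1 : ℝ) else 0) (γ ∪ C)) -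
            ((fun X : Finset (Sym2 V) => if (e₁ ∈ X ∧ (e₂ ∈ X ∨ e₃ ∈ X ∨ e₄ ∈ X)) ∨ (e₂ ∈ X ∧ e₃ ∈ X ∧ e₄ ∈ X) then (1 : ℝ) else 0) ((insert e₁ (insert e₂ (insert e₃ (insert e₄ N)))) \ γ ∪ C))) *
          (g (γ ∪ C) - g ((insert e₁ (insert e₂ (insert e₃ (insert e₄ N)))) \ γ ∪ C)) ≤ 0 := by
  induction e₁ using Sym2.ind with
  | h a₁ b₁ =>
  induction e₂ using Sym2.ind with
  | h a₂ b₂ =>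
  induction e₃ using Sym2.ind with
  | h a₃ b₃ =>
  induction e₄ using Sym2.ind with
  | h a₄ b₄ =>
  -- re-root `H` at `e₁`
  have hR : IsTTSP ((insert s(s, t) E).erase s(a₁, b₁)) a₁ b₁ :=
    hE.reroot_erase h₁ (insert_ne_singleton_of_isTTSP hE hst _)
  have hx' : s(a₁, b₁) ∉ (insert s(s, t) E).erase s(a₁, b₁) := Finset.notMem_erase _ _
  have hy' : s(a₂, b₂) ∈ (insert s(s, t) E).erase s(a₁, b₁) := Finset.mem_erase.2 ⟨fun h => h₁₂ h.symm, h₂⟩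
  have hz' : s(a₃, b₃) ∈ (insert s(s, t) E).erase s(a₁, b₁) := Finset.mem_erase.2 ⟨fun h => h₁₃ h.symm, h₃⟩
  have hw' : s(a₄, b₄) ∈ (insert s(s, t) E).erase s(a₁, b₁) := Finset.mem_erase.2 ⟨fun h => h₁₄ h.symm, h₄⟩
  exact RootForm.t2_levels_le_nonpos_of_isTTSP hR hx' hy' hz' hw' h₂₃ h₂₄ h₃₄ hN hC hNC hg₁ hg₂ hg₃ hg₄ hmono J

/-- **`C_∞⁺` AT LEVEL 4 ON SERIES–PARALLEL GRAPHS (levelwise form), UNCONDITIONAL.**  `𝓔` TTSP between `a, b`, `x = ab ∉ 𝓔` (so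
`H = 𝓔 ∪ {x}` is an ARBITRARY 2-connected series–parallel graph), `y, z, w ∈ 𝓔` three further distinct special edges, `(M, C)` any cell of
`𝓔 \ {y,z,w}`; `f` ANY increasing function reading only `x, y, z, w`; `g` increasing and blind to them.  With `M' = {x,y,z,w} ∪ M`, for every
level cut-off `J`: `Σ_{γ ⊆ M' : k(γ∪C)+k((M'\γ)∪C) ≤ J} (f(γ∪C) − f((M'\γ)∪C))·(g(γ∪C) − g((M'\γ)∪C)) ≤ 0`, i.e. every coefficient — in
the edge odds and in the cluster weight `q` — of `Z_H(z,q)² Cov_{φ_{z,q}}(f, g)/(q − 1)` on this cell is nonnegative: Conjecture `C_∞⁺` at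
level 4 (memo FROM-fk-2-g21 §1) on series–parallel graphs.  File 64h modulo `T2⁺`; `T2⁺` = files 74f/74g (`apPsiC_levels_le_t2Set_nonpos_of_isTTSP`).
[cite: Grimmett2006, §1.4 eq. (1.20) (p. 15); §3.8 Thm. (3.90) (pp. 61–62); §3.9 (pp. 63–64); §6.1 eq. (6.3) (p. 133)]
[cite: Wagner2006, Thm. 5.8(d), §5.3] -/
theorem apPsiC_levels_le_read4_nonpos_of_isTTSP {E : Finset (Sym2 V)} {a b : V} (hE : IsTTSP E a b) (hx : s(a, b) ∉ E)
    {y z w : Sym2 V} (hy : y ∈ E) (hz : z ∈ E) (hw : w ∈ E) (hyz : y ≠ z) (hyw : y ≠ w) (hzw : z ≠ w)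
    {M C : Finset (Sym2 V)} (hM : M ⊆ ((E.erase y).erase z).erase w) (hC : C ⊆ ((E.erase y).erase z).erase w)
    (hMC : Disjoint M C) {f : Finset (Sym2 V) → ℝ}
    (hf : ∀ A B : Finset (Sym2 V), (∀ e ∈ ({s(a, b), y, z, w} : Finset (Sym2 V)), (e ∈ A ↔ e ∈ B)) → f A = f B)
    (hfm : ∀ ⦃X Y : Finset (Sym2 V)⦄, X ⊆ Y → f X ≤ f Y) {g : Finset (Sym2 V) → ℝ}
    (hg : ∀ A U : Finset (Sym2 V), U ⊆ ({s(a, b), y, z, w} : Finset (Sym2 V)) → g (A ∪ U) = g A)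
    (hmono : ∀ ⦃X Y : Finset (Sym2 V)⦄, X ⊆ Y → g X ≤ g Y) (J : ℕ) :
    ∑ γ ∈ (insert s(a, b) (insert y (insert z (insert w M)))).powerset with
        apExpC (insert s(a, b) (insert y (insert z (insert w M)))) C γ ≤ J,
      (f (γ ∪ C) - f ((insert s(a, b) (insert y (insert z (insert w M)))) \ γ ∪ C)) *
        (g (γ ∪ C) - g ((insert s(a, b) (insert y (insert z (insert w M)))) \ γ ∪ C)) ≤ 0 := by
  refine apPsiC_levels_le_read4_nonpos_of_T2 hE hx hy hz hw hyz hyw hzw hM hC hMC hf hfm hg hmono J ?_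
  -- names and the bookkeeping facts of the cell (as in file 64h)
  set x : Sym2 V := s(a, b) with hxdef
  set M' : Finset (Sym2 V) := insert x (insert y (insert z (insert w M))) with hM'def
  have hMe : M ⊆ E := hM.trans (((Finset.erase_subset _ _).trans (Finset.erase_subset _ _)).trans (Finset.erase_subset _ _))
  have hCe : C ⊆ E := hC.trans (((Finset.erase_subset _ _).trans (Finset.erase_subset _ _)).trans (Finset.erase_subset _ _))
  have hxy : x ≠ y := fun h => hx (h ▸ hy)
  have hxz : x ≠ z := fun h => hx (h ▸ hz)
  have hxw : x ≠ w := fun h => hx (h ▸ hw)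
  have hxM : x ∉ M := fun h => hx (hMe h)
  have hxC : x ∉ C := fun h => hx (hCe h)
  have hwM : w ∉ M := fun h => (Finset.mem_erase.1 (hM h)).1 rfl
  have hzM : z ∉ M := fun h => (Finset.mem_erase.1 (Finset.mem_of_mem_erase (hM h))).1 rfl
  have hyM : y ∉ M := fun h => (Finset.mem_erase.1 (Finset.mem_of_mem_erase (Finset.mem_of_mem_erase (hM h)))).1 rfl
  have hwC : w ∉ C := fun h => (Finset.mem_erase.1 (hC h)).1 rfl
  have hzC : z ∉ C := fun h => (Finset.mem_erase.1 (Finset.mem_of_mem_erase (hC h))).1 rfl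
  have hyC : y ∉ C := fun h => (Finset.mem_erase.1 (Finset.mem_of_mem_erase (Finset.mem_of_mem_erase (hC h)))).1 rfl
  have hSH : ({x, y, z, w} : Finset (Sym2 V)) ⊆ insert x E :=
    Finset.insert_subset (Finset.mem_insert_self _ _) (Finset.insert_subset (Finset.mem_insert_of_mem hy)
      (Finset.insert_subset (Finset.mem_insert_of_mem hz) (Finset.singleton_subset_iff.2 (Finset.mem_insert_of_mem hw))))
  have hSC : Disjoint ({x, y, z, w} : Finset (Sym2 V)) C := by
    rw [Finset.disjoint_insert_left, Finset.disjoint_insert_left, Finset.disjoint_insert_left, Finset.disjoint_singleton_left]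
    exact ⟨hxC, hyC, hzC, hwC⟩
  have hgins : ∀ e ∈ ({x, y, z, w} : Finset (Sym2 V)), ∀ A : Finset (Sym2 V), g (insert e A) = g A := by
    intro e he A
    rw [Finset.insert_eq, Finset.union_comm]
    exact hg A {e} (Finset.singleton_subset_iff.2 he)
  have hMS : ∀ m ∈ M, m ∉ ({x, y, z, w} : Finset (Sym2 V)) := by
    intro m hm h
    simp only [Finset.mem_insert, Finset.mem_singleton] at h
    rcases h with rfl | rfl | rfl | rfl
    · exact hxM hm
    · exact hyM hm
    · exact hzM hm
    · exact hwM hm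
  have hCS : ∀ m ∈ C, m ∉ ({x, y, z, w} : Finset (Sym2 V)) := fun m hm h => Finset.disjoint_left.1 hSC h hm
  have hAr4 : ∀ {e₁ e₂ e₃ e₄ : Sym2 V}, e₁ ∈ ({x, y, z, w} : Finset (Sym2 V)) → e₂ ∈ ({x, y, z, w} : Finset (Sym2 V)) →
      e₃ ∈ ({x, y, z, w} : Finset (Sym2 V)) → e₄ ∈ ({x, y, z, w} : Finset (Sym2 V)) → ∀ {A : Finset (Sym2 V)}, A ⊆ E →
      (∀ m ∈ A, m ∉ ({x, y, z, w} : Finset (Sym2 V))) → A ⊆ ((((insert x E).erase e₁).erase e₂).erase e₃).erase e₄ := by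
    intro e₁ e₂ e₃ e₄ h1 h2 h3 h4 A hA hAS m hm
    exact Finset.mem_erase.2 ⟨fun h => hAS m hm (h ▸ h4), Finset.mem_erase.2 ⟨fun h => hAS m hm (h ▸ h3), Finset.mem_erase.2
      ⟨fun h => hAS m hm (h ▸ h2), Finset.mem_erase.2 ⟨fun h => hAS m hm (h ▸ h1), Finset.mem_insert_of_mem (hA hm)⟩⟩⟩⟩
  -- `T2` rays: file 74g re-rooted at the hub `e₁`
  have T2R : ∀ e₁ e₂ e₃ e₄ : Sym2 V, e₁ ∈ ({x, y, z, w} : Finset (Sym2 V)) → e₂ ∈ ({x, y, z, w} : Finset (Sym2 V)) →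
      e₃ ∈ ({x, y, z, w} : Finset (Sym2 V)) → e₄ ∈ ({x, y, z, w} : Finset (Sym2 V)) →
      e₁ ≠ e₂ → e₁ ≠ e₃ → e₁ ≠ e₄ → e₂ ≠ e₃ → e₂ ≠ e₄ → e₃ ≠ e₄ →
      insert e₁ (insert e₂ (insert e₃ (insert e₄ M))) = M' →
      ∑ γ ∈ M'.powerset with apExpC M' C γ ≤ J,
        ((if (e₁ ∈ γ ∪ C ∧ (e₂ ∈ γ ∪ C ∨ e₃ ∈ γ ∪ C ∨ e₄ ∈ γ ∪ C)) ∨ (e₂ ∈ γ ∪ C ∧ e₃ ∈ γ ∪ C ∧ e₄ ∈ γ ∪ C) then (1 : ℝ) else 0) -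
          (if (e₁ ∈ M' \ γ ∪ C ∧ (e₂ ∈ M' \ γ ∪ C ∨ e₃ ∈ M' \ γ ∪ C ∨ e₄ ∈ M' \ γ ∪ C)) ∨
              (e₂ ∈ M' \ γ ∪ C ∧ e₃ ∈ M' \ γ ∪ C ∧ e₄ ∈ M' \ γ ∪ C) then (1 : ℝ) else 0)) *
          (g (γ ∪ C) - g (M' \ γ ∪ C)) ≤ 0 := by
    intro e₁ e₂ e₃ e₄ m1 m2 m3 m4 h12 h13 h14 h23 h24 h34 hI
    have key := apPsiC_levels_le_t2Set_nonpos_of_isTTSP hE hx (hSH m1) (hSH m2) (hSH m3) (hSH m4) h12 h13 h14 h23 h24 h34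
      (hAr4 m1 m2 m3 m4 hMe hMS) (hAr4 m1 m2 m3 m4 hCe hCS) hMC (hgins e₁ m1) (hgins e₂ m2) (hgins e₃ m3) (hgins e₄ m4) hmono J
    rw [hI] at key
    exact key
  have mx : x ∈ ({x, y, z, w} : Finset (Sym2 V)) := by simp
  have my : y ∈ ({x, y, z, w} : Finset (Sym2 V)) := by simp
  have mz : z ∈ ({x, y, z, w} : Finset (Sym2 V)) := by simp
  have mw : w ∈ ({x, y, z, w} : Finset (Sym2 V)) := by simp
  -- the dispatch over the four `T2` rays
  intro r hr
  obtain ⟨k, hk⟩ := r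
  change 19 ≤ k at hr
  interval_cases k
  · simp only [OddCone.ray4_val19 (r := ⟨19, hk⟩) rfl]
    exact T2R x y z w mx my mz mw hxy hxz hxw hyz hyw hzw rfl
  · simp only [OddCone.ray4_val20 (r := ⟨20, hk⟩) rfl]
    exact T2R y x z w my mx mz mw hxy.symm hyz hyw hxz hxw hzw (by rw [hM'def]; ext e; clear * -; simp only [Finset.mem_insert]; tauto)
  · simp only [OddCone.ray4_val21 (r := ⟨21, hk⟩) rfl]
    exact T2R z x y w mz mx my mw hxz.symm hyz.symm hzw hxy hxw hyw (by rw [hM'def]; ext e; clear * -; simp only [Finset.mem_insert]; tauto)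
  · simp only [OddCone.ray4_val22 (r := ⟨22, hk⟩) rfl]
    exact T2R w x y z mw mx my mz hxw.symm hyw.symm hzw.symm hxy hxz hyz (by rw [hM'def]; ext e; clear * -; simp only [Finset.mem_insert]; tauto)

/-- **COROLLARY (`C_∞` at level 4 for every `0 ≤ q ≤ 1` on every 2-connected series–parallel graph, via the Abel bridge of `…Qfree`).**
In the setting of `apPsiC_levels_le_read4_nonpos_of_isTTSP`: `apPsiC q (M ∪ {x,y,z,w}) C f g ≤ 0`, i.e. the antipodal
(squared-partition-function) form of `Cov_{φ_{p,q}}(f, g) ≥ 0` holds coefficientwise in the edge odds for every random-cluster measure with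
`q ≤ 1` on `H = 𝓔 ∪ x`, for every increasing `f` of the four edges `x, y, z, w` and every increasing `g` blind to them, in every cell.
[cite: Grimmett2006, §3.8 Thm. (3.90) (pp. 61–62); §3.9 (pp. 63–64)] [cite: Wagner2006, Thm. 5.8(d), §5.3] -/
theorem apPsiC_read4_nonpos_of_isTTSP {q : ℝ} (hq0 : 0 ≤ q) (hq1 : q ≤ 1) {E : Finset (Sym2 V)} {a b : V} (hE : IsTTSP E a b)
    (hx : s(a, b) ∉ E) {y z w : Sym2 V} (hy : y ∈ E) (hz : z ∈ E) (hw : w ∈ E) (hyz : y ≠ z) (hyw : y ≠ w) (hzw : z ≠ w)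
    {M C : Finset (Sym2 V)} (hM : M ⊆ ((E.erase y).erase z).erase w) (hC : C ⊆ ((E.erase y).erase z).erase w)
    (hMC : Disjoint M C) {f : Finset (Sym2 V) → ℝ}
    (hf : ∀ A B : Finset (Sym2 V), (∀ e ∈ ({s(a, b), y, z, w} : Finset (Sym2 V)), (e ∈ A ↔ e ∈ B)) → f A = f B)
    (hfm : ∀ ⦃X Y : Finset (Sym2 V)⦄, X ⊆ Y → f X ≤ f Y) {g : Finset (Sym2 V) → ℝ}
    (hg : ∀ A U : Finset (Sym2 V), U ⊆ ({s(a, b), y, z, w} : Finset (Sym2 V)) → g (A ∪ U) = g A)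
    (hmono : ∀ ⦃X Y : Finset (Sym2 V)⦄, X ⊆ Y → g X ≤ g Y) :
    apPsiC q (insert s(a, b) (insert y (insert z (insert w M)))) C f g ≤ 0 :=
  sum_pow_mul_nonpos_of_levels_le (insert s(a, b) (insert y (insert z (insert w M)))).powerset
    (apExpC (insert s(a, b) (insert y (insert z (insert w M)))) C)
    (fun γ => (f (γ ∪ C) - f ((insert s(a, b) (insert y (insert z (insert w M)))) \ γ ∪ C)) *
      (g (γ ∪ C) - g ((insert s(a, b) (insert y (insert z (insert w M)))) \ γ ∪ C)))
    hq0 hq1 fun J => apPsiC_levels_le_read4_nonpos_of_isTTSP hE hx hy hz hw hyz hyw hzw hM hC hMC hf hfm hg hmono J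

end FK

end Summit.CriticalPhenomena.PercolationContinuityZ3.Theorems

end
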